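import Literature.AlgebraicGeometry.Frobenioids.ArchimedeanFrobeniusAmple
import Literature.AlgebraicGeometry.Frobenioids.ArchimedeanFrobenioidRelative
import HarnessLib

/-!
# Frobenioids II, Example 3.3 (ii): endomorphisms of non-isotropic objects of `C` — ASSEMBLY

Mochizuki, *The geometry of Frobenioids II: poly-Frobenioids*, Kyushu J. Math. **62** (2008)
401–460, §3, Example 3.3 (ii), author's text p. 28 [cite: MochizukiFrdII2008, Ex 3.3 (ii) p.28]:
"by Lemma 3.2, (iv), every endomorphism of a non-isotropic object of `C` is linear and co-angular".

DISCHARGES `Ex33ii_endo_of_not_isotropic π` by assembling the two halves: LINEAR —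
`C.isLinear_endo_of_not_isIsotropic` (abc-iut-L1-t6, `ArchimedeanFrobeniusAmple.lean`: an endomorphism
of degree `≥ 2` forces isotropy, Lemma 3.2 (iv)); CO-ANGULAR — `C.isCoAngular_endo` (abc-iut-L1-d7,
`ArchimedeanFrobenioidRelative.lean`: every endomorphism of `C` is co-angular, [FrdI] Def. 1.3 (iii)(b)
for `C₀` transported along the first projection).
-/

namespace Literature.AlgebraicGeometry.Frobenioids

open CategoryTheory

namespace ArchFrd

universe v u

variable {D : Type u} [Category.{v} D] (π : D ⥤ D0)

/-- **Example 3.3 (ii)**: every endomorphism of a non-isotropic object of `C` is linear and co-angular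
— PROVED (assembly of t6's linearity half and d7's co-angularity half).
[cite: MochizukiFrdII2008, Ex 3.3 (ii) p.28] -/
theorem Ex33ii_endo_of_not_isotropic_holds :
    Literature.AlgebraicGeometry.Frobenioids.ArchFrd.Ex33ii_endo_of_not_isotropic π := fun X φ hX =>
  ⟨C.isLinear_endo_of_not_isIsotropic π X φ hX, C.isCoAngular_endo π X φ⟩

end ArchFrd

end Literature.AlgebraicGeometry.Frobenioids
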